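import Mathlib.Data.Real.Basic
import Mathlib.Tactic.Linarith
import Mathlib.Tactic.Ring
import Mathlib.Tactic.Positivity
import HarnessLib
import Summits.CriticalPhenomena.PercolationContinuityZ3.Theorems.PercNearOneGluingNoHeavyLowerTailIncStarTwoCutRealLemmas

/-!
# Two-cuts with the root and one target on the root side (MODE B), II: the real core of the A-part

Support file for the Sahi programme (`--supports stmt-CriticalPhenomena-4575`, prover prim-sahi-p2 gen 25).  No definitions, no named
facts, no sorries; standard axioms.  Memo `run/shared/lean/prim/prim-sahi/FROM-prim-sahi-p2-gen25-MODE-B-CONE.md` §3 (Steps 1–4) and §4b.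

With the notation of `…IncStarTwoCutRealLemmas`: a pseudo-law `(aX, aY, aXY)` of total mass `≤ α` over the root-port classes satisfying the
Harris rows for `{s~x}`, `{s~y}`, `{s~x ∨ s~y}`, `{s~x ∧ s~y}` and the near star row `S ≥ 0` (the cone `C⁺_q` of the memo), far TYPE marginals
`b′x = P(T_b = x)`, `b′y`, `b∩ = P(T_b = xy)` (and for `c`), and the three far covariances `CovX = Cov(B_x,C_x)`, `CovY`, `CovU = Cov(B_∪,C_∪)` with
Harris (`≥ 0`) and the elementary bounds `CovX ≤ CovU + b_x c′y + b′y c_x + b′y c′y` (from `P(B_xC_x) ≤ P(B_∪C_∪)`), we prove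
`0 ≤ PP + κX·CovX + κY·CovY + κXY·CovU`, `PP = Σ_{T,U} P(T_b=T)P(T_c=U)·e(T,U)`, `κX = 2aX − α(x̄−w)`, `κY = 2aY − α(ȳ−w)`, `κXY = 2aXY − αw` —
which by the memo's Step 1 identity is `E₃(A, S_b, S_c)` (the A-part of Sahi's `E₃` across the two-cut), resp. `value(u′)` in the assembly (B1) of §4b.
The proof is the charging argument of Step 3: a negative `κX` is moved onto `CovU` and onto the product cells, where the lemmas of part I pay for it.
-/

namespace Summit.CriticalPhenomena.PercolationContinuityZ3.Theorems

namespace IncStarTwoCut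

/-- **A-part of THEOREM B⁺, real core** (memo §3).  See the module docstring for the dictionary; all `e…`, `κ…`, `S`, `PP` are passed as
variables with their defining equations. [this work] -/
theorem twoCut_Apart_nonneg
    {xb yb w α aX aY aXY bpx bpy bn cpx cpy cn covX covY covU S exx eyy exU eyU eUU κX κY κXY PP : ℝ}
    -- elementary constraints on the class law q
    (hw0 : 0 ≤ w) (hwx : w ≤ xb) (hwy : w ≤ yb) (hxb1 : xb ≤ 1) (hyb1 : yb ≤ 1) (hc : xb * yb ≤ w) (hq0 : xb + yb - 1 ≤ w)
    -- the pseudo-law and its cone constraints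
    (haX : 0 ≤ aX) (haY : 0 ≤ aY) (haXY : 0 ≤ aXY) (hpUα : aX + aY + aXY ≤ α)
    (hHx : xb * α ≤ aX + aXY) (hHy : yb * α ≤ aY + aXY) (hHu : (xb + yb - w) * α ≤ aX + aY + aXY) (hHw : w * α ≤ aXY)
    (hSdef : S = 2 * aXY - (aX + aXY) * yb - (aY + aXY) * xb - (w - xb * yb) * α) (hS : 0 ≤ S)
    -- far type marginals and covariances
    (hbpx : 0 ≤ bpx) (hbpy : 0 ≤ bpy) (hbn : 0 ≤ bn) (hcpx : 0 ≤ cpx) (hcpy : 0 ≤ cpy) (hcn : 0 ≤ cn)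
    (hcovX : 0 ≤ covX) (hcovY : 0 ≤ covY) (hcovU : 0 ≤ covU)
    (hcovXle : covX ≤ covU + ((bpx + bn) * cpy + bpy * (cpx + cn) + bpy * cpy))
    (hcovYle : covY ≤ covU + ((bpy + bn) * cpx + bpx * (cpy + cn) + bpx * cpx))
    -- definitions
    (hexx : exx = (1 - xb) * (2 * (aX + aXY) - α * xb)) (heyy : eyy = (1 - yb) * (2 * (aY + aXY) - α * yb))
    (hexU : exU = (aX + aXY) * (2 - (xb + yb - w)) - xb * (aX + aY + aXY) - α * xb * (1 - (xb + yb - w)))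
    (heyU : eyU = (aY + aXY) * (2 - (xb + yb - w)) - yb * (aX + aY + aXY) - α * yb * (1 - (xb + yb - w)))
    (heUU : eUU = (1 - (xb + yb - w)) * (2 * (aX + aY + aXY) - α * (xb + yb - w)))
    (hκX : κX = 2 * aX - α * (xb - w)) (hκY : κY = 2 * aY - α * (yb - w)) (hκXY : κXY = 2 * aXY - α * w)
    (hPP : PP = bpx * cpx * exx + (bpx * cpy + bpy * cpx) * S + bpy * cpy * eyy
        + (bpx * cn + bn * cpx) * exU + (bpy * cn + bn * cpy) * eyU + bn * cn * eUU) :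
    0 ≤ PP + κX * covX + κY * covY + κXY * covU := by
  -- basic derived facts
  have hxb0 : 0 ≤ xb := le_trans hw0 hwx
  have hyb0 : 0 ≤ yb := le_trans hw0 hwy
  have hα : 0 ≤ α := le_trans (add_nonneg (add_nonneg haX haY) haXY) hpUα
  have hub1 : xb + yb - w ≤ 1 := by linarith only [hq0]
  -- Step 2: every e ≥ 0
  have Exx : 0 ≤ exx := by rw [hexx]; exact e_xx_nonneg hxb1 (by linarith) hHx
  have Eyy : 0 ≤ eyy := by rw [heyy]; exact e_xx_nonneg hyb1 (by linarith) hHy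
  have ExU : 0 ≤ exU := by rw [hexU]; exact e_xU_nonneg hxb0 (by linarith) hpUα hHx
  have EyU : 0 ≤ eyU := by rw [heyU]; exact e_xU_nonneg hyb0 (by linarith) hpUα hHy
  have EUU : 0 ≤ eUU := by rw [heUU]; exact e_UU_nonneg hub1 (by linarith) hHu
  -- Step 4: the charges kX = -κX, kY = -κY are paid
  have CSsum : -κX + -κY ≤ S := by
    rw [hκX, hκY, hSdef]
    have := star_ge_charge_sum (xb := xb) (yb := yb) (w := w) (α := α) (aX := aX) (aY := aY) (aXY := aXY)
      haX haY hα hwx hwy hxb1 hyb1 hw0 hq0 hHu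
    linarith only [this]
  have CSx : -κX ≤ S := by
    rw [hκX, hSdef]
    have := star_ge_charge_x (xb := xb) (yb := yb) (w := w) (α := α) (aX := aX) (aY := aY) (aXY := aXY)
      haX hα hxb0 hxb1 hyb1 hc hHx hpUα
    linarith only [this]
  have CSy : -κY ≤ S := by
    rw [hκY, hSdef]
    have hpUα' : aY + aX + aXY ≤ α := by linarith
    have hc' : yb * xb ≤ w := by linarith [mul_comm xb yb]
    have := star_ge_charge_x (xb := yb) (yb := xb) (w := w) (α := α) (aX := aY) (aY := aX) (aXY := aXY)
      haY hα hyb0 hyb1 hxb1 hc' hHy hpUα'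
    linarith only [this]
  have Cyy : -κX ≤ eyy := by
    rw [hκX, heyy]
    have hHu' : (xb + yb - w) * α ≤ aX + (aY + aXY) := by linarith
    have := e_yy_ge_charge_x (xb := xb) (yb := yb) (w := w) (α := α) (aX := aX) (pY := aY + aXY)
      haX hα hyb0 hyb1 hwx (by linarith only [hq0]) hHu'
    linarith only [this]
  have Cxx : -κY ≤ exx := by
    rw [hκY, hexx]
    have hHu' : (yb + xb - w) * α ≤ aY + (aX + aXY) := by linarith
    have := e_yy_ge_charge_x (xb := yb) (yb := xb) (w := w) (α := α) (aX := aY) (pY := aX + aXY)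
      haY hα hxb0 hxb1 hwy (by linarith only [hq0]) hHu'
    linarith only [this]
  have CyU : -κX ≤ eyU := by
    rw [hκX, heyU]
    have := e_Uy_ge_charge_x (xb := xb) (yb := yb) (w := w) (α := α) (aX := aX) (pY := aY + aXY) (pU := aX + aY + aXY)
      haX hα hyb0 hub1 hwx (by ring) hpUα hHu
    linarith only [this]
  have CxU : -κY ≤ exU := by
    rw [hκY, hexU]
    have hub1' : yb + xb - w ≤ 1 := by linarith
    have hpU' : aY + aX + aXY = aY + (aX + aXY) := by ring
    have hpUα' : aY + aX + aXY ≤ α := by linarith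
    have hHu' : (yb + xb - w) * α ≤ aY + aX + aXY := by linarith
    have := e_Uy_ge_charge_x (xb := yb) (yb := xb) (w := w) (α := α) (aX := aY) (pY := aX + aXY) (pU := aY + aX + aXY)
      haY hα hxb0 hub1' hwy hpU' hpUα' hHu'
    have e1 : (aX + aXY) * (2 - (yb + xb - w)) - xb * (aY + aX + aXY) - α * xb * (1 - (yb + xb - w))
        = (aX + aXY) * (2 - (xb + yb - w)) - xb * (aX + aY + aXY) - α * xb * (1 - (xb + yb - w)) := by ring
    linarith only [this, e1]
  -- coefficients of CovU after charging
  have KU0 : 0 ≤ κXY := by rw [hκXY]; linarith only [hHw, haXY]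
  have KUx : 0 ≤ κXY + κX := by rw [hκXY, hκX]; linarith only [hHx, haX, haXY]
  have KUy : 0 ≤ κXY + κY := by rw [hκXY, hκY]; linarith only [hHy, haY, haXY]
  have KUxy : 0 ≤ κXY + κX + κY := by rw [hκXY, hκX, hκY]; linarith only [hHu, haX, haY, haXY]
  -- products of far marginals
  have Pxx := mul_nonneg hbpx hcpx; have Pxy := mul_nonneg hbpx hcpy; have Pyx := mul_nonneg hbpy hcpx
  have Pyy := mul_nonneg hbpy hcpy; have Pxn := mul_nonneg hbpx hcn; have Pnx := mul_nonneg hbn hcpx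
  have Pyn := mul_nonneg hbpy hcn; have Pny := mul_nonneg hbn hcpy; have Pnn := mul_nonneg hbn hcn
  rcases le_or_gt 0 κX with hX | hX <;> rcases le_or_gt 0 κY with hY | hY
  · -- both coefficients nonnegative: everything is a nonnegative term
    rw [hPP]
    have t1 := mul_nonneg Pxx Exx; have t2 := mul_nonneg (add_nonneg Pxy Pyx) hS; have t3 := mul_nonneg Pyy Eyy
    have t4 := mul_nonneg (add_nonneg Pxn Pnx) ExU; have t5 := mul_nonneg (add_nonneg Pyn Pny) EyU; have t6 := mul_nonneg Pnn EUU
    have t7 := mul_nonneg hX hcovX; have t8 := mul_nonneg hY hcovY; have t9 := mul_nonneg KU0 hcovU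
    linarith only [t1, t2, t3, t4, t5, t6, t7, t8, t9]
  · -- κX ≥ 0, κY < 0: charge kY = -κY on CovU and on the cells (y,x),(xy,x),(x,y),(x,xy),(x,x)
    have hb : κY * (covU + ((bpy + bn) * cpx + bpx * (cpy + cn) + bpx * cpx)) ≤ κY * covY :=
      mul_le_mul_of_nonpos_left hcovYle (le_of_lt hY)
    have hid : PP + κX * covX + κY * (covU + ((bpy + bn) * cpx + bpx * (cpy + cn) + bpx * cpx)) + κXY * covU
        = κX * covX + (κXY + κY) * covU
          + bpx * cpx * (exx + κY) + bpx * cpy * (S + κY) + bpy * cpx * (S + κY) + bpy * cpy * eyy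
          + bpx * cn * (exU + κY) + bn * cpx * (exU + κY) + (bpy * cn + bn * cpy) * eyU + bn * cn * eUU := by
      rw [hPP]; ring
    have t1 := mul_nonneg Pxx (by linarith only [Cxx] : 0 ≤ exx + κY); have t2 := mul_nonneg Pxy (by linarith only [CSy] : 0 ≤ S + κY)
    have t3 := mul_nonneg Pyx (by linarith only [CSy] : 0 ≤ S + κY); have t4 := mul_nonneg Pyy Eyy
    have t5 := mul_nonneg Pxn (by linarith only [CxU] : 0 ≤ exU + κY); have t6 := mul_nonneg Pnx (by linarith only [CxU] : 0 ≤ exU + κY)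
    have t7 := mul_nonneg (add_nonneg Pyn Pny) EyU; have t8 := mul_nonneg Pnn EUU
    have t9 := mul_nonneg hX hcovX; have t10 := mul_nonneg KUy hcovU
    linarith only [hid, hb, t1, t2, t3, t4, t5, t6, t7, t8, t9, t10]
  · -- κX < 0, κY ≥ 0: charge kX on CovU and on the cells (x,y),(xy,y),(y,x),(y,xy),(y,y)
    have hb : κX * (covU + ((bpx + bn) * cpy + bpy * (cpx + cn) + bpy * cpy)) ≤ κX * covX :=
      mul_le_mul_of_nonpos_left hcovXle (le_of_lt hX)
    have hid : PP + κX * (covU + ((bpx + bn) * cpy + bpy * (cpx + cn) + bpy * cpy)) + κY * covY + κXY * covU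
        = κY * covY + (κXY + κX) * covU
          + bpx * cpx * exx + bpx * cpy * (S + κX) + bpy * cpx * (S + κX) + bpy * cpy * (eyy + κX)
          + (bpx * cn + bn * cpx) * exU + bpy * cn * (eyU + κX) + bn * cpy * (eyU + κX) + bn * cn * eUU := by
      rw [hPP]; ring
    have t1 := mul_nonneg Pxx Exx; have t2 := mul_nonneg Pxy (by linarith only [CSx] : 0 ≤ S + κX)
    have t3 := mul_nonneg Pyx (by linarith only [CSx] : 0 ≤ S + κX); have t4 := mul_nonneg Pyy (by linarith only [Cyy] : 0 ≤ eyy + κX)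
    have t5 := mul_nonneg (add_nonneg Pxn Pnx) ExU; have t6 := mul_nonneg Pyn (by linarith only [CyU] : 0 ≤ eyU + κX)
    have t7 := mul_nonneg Pny (by linarith only [CyU] : 0 ≤ eyU + κX); have t8 := mul_nonneg Pnn EUU
    have t9 := mul_nonneg hY hcovY; have t10 := mul_nonneg KUx hcovU
    linarith only [hid, hb, t1, t2, t3, t4, t5, t6, t7, t8, t9, t10]
  · -- both negative: both charges
    have hbX : κX * (covU + ((bpx + bn) * cpy + bpy * (cpx + cn) + bpy * cpy)) ≤ κX * covX :=
      mul_le_mul_of_nonpos_left hcovXle (le_of_lt hX)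
    have hbY : κY * (covU + ((bpy + bn) * cpx + bpx * (cpy + cn) + bpx * cpx)) ≤ κY * covY :=
      mul_le_mul_of_nonpos_left hcovYle (le_of_lt hY)
    have hid : PP + κX * (covU + ((bpx + bn) * cpy + bpy * (cpx + cn) + bpy * cpy))
        + κY * (covU + ((bpy + bn) * cpx + bpx * (cpy + cn) + bpx * cpx)) + κXY * covU
        = (κXY + κX + κY) * covU
          + bpx * cpx * (exx + κY) + bpx * cpy * (S + κX + κY) + bpy * cpx * (S + κX + κY) + bpy * cpy * (eyy + κX)
          + bpx * cn * (exU + κY) + bn * cpx * (exU + κY) + bpy * cn * (eyU + κX) + bn * cpy * (eyU + κX) + bn * cn * eUU := by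
      rw [hPP]; ring
    have t1 := mul_nonneg Pxx (by linarith only [Cxx] : 0 ≤ exx + κY); have t2 := mul_nonneg Pxy (by linarith only [CSsum] : 0 ≤ S + κX + κY)
    have t3 := mul_nonneg Pyx (by linarith only [CSsum] : 0 ≤ S + κX + κY); have t4 := mul_nonneg Pyy (by linarith only [Cyy] : 0 ≤ eyy + κX)
    have t5 := mul_nonneg Pxn (by linarith only [CxU] : 0 ≤ exU + κY); have t6 := mul_nonneg Pnx (by linarith only [CxU] : 0 ≤ exU + κY)
    have t7 := mul_nonneg Pyn (by linarith only [CyU] : 0 ≤ eyU + κX); have t8 := mul_nonneg Pny (by linarith only [CyU] : 0 ≤ eyU + κX)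
    have t9 := mul_nonneg Pnn EUU; have t10 := mul_nonneg KUxy hcovU
    linarith only [hid, hbX, hbY, t1, t2, t3, t4, t5, t6, t7, t8, t9, t10]

end IncStarTwoCut

end Summit.CriticalPhenomena.PercolationContinuityZ3.Theorems
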